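import Summits.Ventures.CertifiedManyBodySolver.Theorems.M3x2EdgeSplitSymReplayBoxCanonZ
import Summits.Ventures.CertifiedManyBodySolver.Theorems.M3x2EdgeSplitSymReplayOutRoute


/-!
# SymReplay — E5 «ORACLE CANON»: the OUTROUTE share canonicalised by VERIFYING an untrusted hint per term — soundness for every oracle

The box canon of record (`…BoxCanon`, closed-form twin `…BoxCanonZ`) finds a term's canonical image by moving the word under all eight
point-group elements, anchoring, normal-ordering each image and selecting the minimum (≈ 1.5–1.9 ms per word under the gate's evaluator on
rung-V words).  Minimality is used NOWHERE in soundness (`canonTermA_sound`): any licensed move gives a valid identification use.  So let an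
UNTRUSTED ORACLE `oracle : Word → HintT` name, per residual term `t = (q, u)`, ONE move `(γ, v)` — and, when it claims the class cancels, a
PARTNER move `(γ', v')` — and VERIFY only: (1) the move is licensed (`suppIn (moveWordF γ v u) frame`, box form `inBox lo hi (moveWordZ γ v u)`),
(2) the image is computed by the TREE (`nfWord` of the moved word), (3) for a zero claim, the partner is licensed and its image is the same
polynomial with the opposite sign (`polyNegEq`), in which case the term contributes nothing and its two half-uses cancel it.  A wrong oracle
can only leave a non-cancelling image (the module's `isZero` fails); it can never certify a false bound.  Completeness (every share cancels
when the oracle is the packed box canon) is the producer's business, exactly as for the output key `κ` of `…OutRoute`.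

MEASURED (hub-lb-sym-plan-1 g4 / hub-lb-sym-ref-1 g1, interpreted = gate mode, real rung-V residual words): packed oracle (`canonPH`,
hub-lb-sym-ref-1) 155–263 µs/word, hint verification 0 failures / 14 000, verified step `nfWord ∘ moveWordV` 120 µs/image resp. `∘ moveWordZ`
54 µs/image; fact-side cost oracle + verified step ≈ 215–390 µs/word against 1 500–2 600 for `canonTermAB` in the same runs (÷4.2 with
`moveWordV`, ÷6.3–7.4 with `moveWordZ`).

CONTENTS.  (a) `HintT`, the validated partner `partnerOf`, the hinted term canon `canonTermHW` / `canonTermH` with its uses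
`usesOfTermHW` / `usesOfTermH`, and the per-term identity `canonTermHW_sound` (twin of `canonTermA_sound`) summed to `sum_canonTermH`;
the hinted zero-filtered pipe `canonNFZH` with `canonNFZH_expansion` / `canonNFZHUses_supp` (twins of `…LocalB`); (b) OUTROUTE plumbing:
per-module facts `outOKH` / `OutFactsH`, `wardD4CertGe_of_outrouteH`, `energyDensity_ge_of_outrouteH` (twins of `…OutRoute` (c), closed through
`wardD4CertGe_of_expansion` fed as in `wardD4CertGe_of_facts₂ZR`); (c) BOX form under `boxLicence` (path of record for box frames):
`partnerOfB`, `canonTermHWB`, `canonNFZHB`, `outOKHB` / `OutFactsHB` with their `_eq` lemmas and `energyDensity_ge_of_outrouteHB`; (d) the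
EXECUTED form with the closed-form move of `…BoxCanonZ`: `partnerOfBZ`, `canonTermHWBZ`, `canonNFZHBZ`, `outOKHBZ` / `OutFactsHBZ`, equal to
(c) as functions (`…BZ_eq`, by `moveWordZ_eq'`), and the closing `energyDensity_ge_of_outrouteHBZ`.

CLOSING GRAMMAR (R-literal `K`; literals `J`, `lo hi`; a landed ORACLE `oracle : Word → HintT`, e.g. the packed box canon with its
adapter; an output key `κ`, e.g. `pairKey`):  `hwf : wellFormed K.expand = true`, `hbox : boxLicence K.frame lo hi = true`,
`hRok : K.gramR.all (gramBlockROK K.frame) = true`; per module `i < J` one file `theorem out_i : outOKHBZ K oracle κ J lo hi i = true := by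
native_decide` (the oracle runs INSIDE this evaluation; no hint data and no partial is shipped); close
`energyDensity_ge_of_outrouteHBZ K hwf hRok oracle κ J hJ lo hi hbox ⟨out_0, …, out_{J-1}, trivial⟩`.

HONEST FRAMING: checker plumbing (a rate lever for the canon third) with its soundness theorem, oracle-agnostic; no oracle is defined
here and no certificate is replayed; no bound of record moves; no summit or crux statement is proved; nothing here predicts
superconductivity.
-/

namespace Summit.Ventures.CertifiedManyBodySolver.Theorems.SymReplay.E5L

open Literature.MathematicalPhysics.QuantumLattice
open Literature.MathematicalPhysics.QuantumLattice.HubbardWave0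
open Literature.MathematicalPhysics.QuantumLattice.ThermodynamicLimit
open Literature.Probability.LatticeModels
open Literature.MathematicalPhysics.QuantumManyBody.StateRelaxation
open Summit.Ventures.CertifiedManyBodySolver.Theorems.WardSlot

/-! ##### (a) Hints, the hinted term canon, soundness for every hint -/

structure HintT where
  γ : DihedralGroup 4
  v : Site 2
  partner : Option (DihedralGroup 4 × Site 2)

/-- The validated partner: present only if its move is licensed and its image is the negated image. -/
def partnerOf (frame : List (Site 2)) (h : HintT) (u : Word) : Option (DihedralGroup 4 × Site 2) :=
  match h.partner with
  | none => none
  | some p =>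
    if suppIn (moveWordF p.1 p.2 u) frame && polyNegEq (nfWord (moveWordF h.γ h.v u)) (nfWord (moveWordF p.1 p.2 u))
    then some p else none

/-- A validated partner is licensed and its image is the negated image. -/
theorem partnerOf_spec {frame : List (Site 2)} {h : HintT} {u : Word} {p : DihedralGroup 4 × Site 2}
    (hp : partnerOf frame h u = some p) :
    suppIn (moveWordF p.1 p.2 u) frame = true ∧
      polyNegEq (nfWord (moveWordF h.γ h.v u)) (nfWord (moveWordF p.1 p.2 u)) = true := by
  unfold partnerOf at hp
  rcases hq : h.partner with _ | p'
  · rw [hq] at hp; simp at hp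
  · rw [hq] at hp
    simp only at hp
    split_ifs at hp with hc
    obtain rfl := Option.some.inj hp
    simpa [Bool.and_eq_true] using hc

/-- Hinted canonical form of one term (total: an unlicensed hint leaves the term unchanged). -/
def canonTermHW (frame : List (Site 2)) (h : HintT) (t : ℚ × Word) : QPoly :=
  if suppIn (moveWordF h.γ h.v t.2) frame then
    match partnerOf frame h t.2 with
    | some _ => []
    | none => pscale t.1 (nfWord (moveWordF h.γ h.v t.2))
  else [t]

/-- Its identification uses (none / one / two halves — the tree's `usesOfTerm` currency `IdUse`). -/
def usesOfTermHW (frame : List (Site 2)) (h : HintT) (t : ℚ × Word) : List IdUse :=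
  if suppIn (moveWordF h.γ h.v t.2) frame then
    match partnerOf frame h t.2 with
    | some p => [⟨-t.1 / 2, t.2, h.γ, h.v⟩, ⟨-t.1 / 2, t.2, p.1, p.2⟩]
    | none => [⟨-t.1, t.2, h.γ, h.v⟩]
  else []

/-- With an oracle. -/
def canonTermH (frame : List (Site 2)) (oracle : Word → HintT) (t : ℚ × Word) : QPoly :=
  canonTermHW frame (oracle t.2) t

/-- Its uses. -/
def usesOfTermH (frame : List (Site 2)) (oracle : Word → HintT) (t : ℚ × Word) : List IdUse :=
  usesOfTermHW frame (oracle t.2) t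

/-- Every use's word is the term's word. -/
theorem usesOfTermHW_u {frame : List (Site 2)} {h : HintT} {t : ℚ × Word} {e : IdUse}
    (he : e ∈ usesOfTermHW frame h t) : e.u = t.2 := by
  unfold usesOfTermHW at he
  split_ifs at he with hs
  · rcases hp : partnerOf frame h t.2 with _ | p
    · rw [hp] at he; simp at he; rw [he]
    · rw [hp] at he; simp at he
      rcases he with rfl | rfl <;> rfl
  · simp at he

/-- **Soundness of the hinted canon on one term, for ANY hint** (twin of `canonTermA_sound`). -/
theorem canonTermHW_sound (h1 : NfFaithful) {Λ' : Finset (Site 2)} (frame : List (Site 2))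
    (hfr : frame.toFinset ⊆ Λ') (h : HintT) (t : ℚ × Word) :
    ((t.1 : ℚ) : ℂ) • wordOp Λ' t.2 - polyOp Λ' (canonTermHW frame h t) =
      ((usesOfTermHW frame h t).map (useOp Λ')).sum := by
  unfold canonTermHW usesOfTermHW
  by_cases hs : suppIn (moveWordF h.γ h.v t.2) frame = true
  · have hw : polyOp Λ' (nfWord (moveWordF h.γ h.v t.2)) = wordOp Λ' (moveWord h.γ h.v t.2) := by
      have := (h1 Λ' _ (((suppIn_iff _ _).1 hs).mono hfr)).symm
      rw [moveWordF_eq] at this ⊢; exact this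
    simp only [hs, if_true]
    rcases hp : partnerOf frame h t.2 with _ | p
    · simp only [List.map_cons, List.map_nil, List.sum_cons, List.sum_nil, add_zero, useOp]
      rw [polyOp_pscale, hw]
      push_cast
      module
    · obtain ⟨hs', hneg'⟩ := partnerOf_spec hp
      have hw' : polyOp Λ' (nfWord (moveWordF p.1 p.2 t.2)) = wordOp Λ' (moveWord p.1 p.2 t.2) := by
        have := (h1 Λ' _ (((suppIn_iff _ _).1 hs').mono hfr)).symm
        rw [moveWordF_eq] at this ⊢; exact this
      have hneg : wordOp Λ' (moveWord p.1 p.2 t.2) = -wordOp Λ' (moveWord h.γ h.v t.2) := by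
        rw [← hw, ← hw']; exact polyOp_of_polyNegEq Λ' _ _ hneg'
      simp only [List.map_cons, List.map_nil, List.sum_cons, List.sum_nil, add_zero, useOp]
      rw [hneg, polyOp_nil, sub_zero]
      push_cast
      module
  · simp only [hs, Bool.false_eq_true, if_false, List.map_nil, List.sum_nil, polyOp_cons, polyOp_nil, add_zero, sub_self]

/-- `canonTermHW_sound` with an oracle. -/
theorem canonTermH_sound (h1 : NfFaithful) {Λ' : Finset (Site 2)} (frame : List (Site 2))
    (hfr : frame.toFinset ⊆ Λ') (oracle : Word → HintT) (t : ℚ × Word) :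
    ((t.1 : ℚ) : ℂ) • wordOp Λ' t.2 - polyOp Λ' (canonTermH frame oracle t) =
      ((usesOfTermH frame oracle t).map (useOp Λ')).sum :=
  canonTermHW_sound h1 frame hfr (oracle t.2) t

/-- Twin of `sum_canonTerm`. -/
theorem sum_canonTermH (h1 : NfFaithful) {Λ' : Finset (Site 2)} (frame : List (Site 2))
    (hfr : frame.toFinset ⊆ Λ') (oracle : Word → HintT) :
    ∀ (N : QPoly), polyOp Λ' N - polyOp Λ' (N.flatMap (canonTermH frame oracle)) =
        ((N.flatMap (usesOfTermH frame oracle)).map (useOp Λ')).sum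
  | [] => by simp
  | t :: N => by
    rw [List.flatMap_cons, List.flatMap_cons, polyOp_append, polyOp_cons, List.map_append, List.sum_append,
      ← sum_canonTermH h1 frame hfr oracle N, ← canonTermH_sound h1 frame hfr oracle t]
    abel

/-- **The hinted zero-filtered pipe**: normal-order, collect, drop zeros, hinted canon (twin of `canonNFZV`). -/
def canonNFZH (frame : List (Site 2)) (oracle : Word → HintT) (p : QPoly) : QPoly :=
  (dropZeros (collect (nfPoly p))).flatMap (canonTermH frame oracle)

/-- The identification uses of the hinted pipe. -/
def canonNFZHUses (frame : List (Site 2)) (oracle : Word → HintT) (p : QPoly) : List IdUse :=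
  (dropZeros (collect (nfPoly p))).flatMap (usesOfTermH frame oracle)

/-- `p ≡ canonNFZH p` up to its identification uses (twin of `canonNFZV_expansion`, LocalB l.61). -/
theorem canonNFZH_expansion {Λ' : Finset (Site 2)} (frame : List (Site 2)) (hfr : frame.toFinset ⊆ Λ')
    (oracle : Word → HintT) (p : QPoly) (hp : PSupp p Λ') :
    polyOp Λ' p = polyOp Λ' (canonNFZH frame oracle p) + ((canonNFZHUses frame oracle p).map (useOp Λ')).sum := by
  have h := sum_canonTermH stub_nfFaithful frame hfr oracle (dropZeros (collect (nfPoly p)))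
  have hc : polyOp Λ' (dropZeros (collect (nfPoly p))) = polyOp Λ' p := by
    rw [polyOp_dropZeros, polyOp_eq_evalP, collect_eval, ← polyOp_eq_evalP, polyOp_nfPoly stub_nfFaithful _ _ hp]
  rw [canonNFZH, canonNFZHUses, ← h, hc]
  abel

/-- The use words of `canonNFZH p` are supported with `p` (twin of `canonNFZUses_supp`). -/
theorem canonNFZHUses_supp (frame : List (Site 2)) (oracle : Word → HintT) (p : QPoly) {Λ : Finset (Site 2)}
    (hp : PSupp p Λ) : ∀ e ∈ canonNFZHUses frame oracle p, SuppIn e.u Λ := by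
  intro e he
  rw [canonNFZHUses, List.mem_flatMap] at he
  obtain ⟨t, ht, he⟩ := he
  rw [usesOfTermHW_u he]
  exact hp.nfPoly.collect.dropZeros t ht

/-! ##### (b) OUTROUTE plumbing for the hinted pipe (twins of `…OutRoute` (c)) -/

/-- Per-module fact, hinted: output class `i` of the raw residual canonicalises to zero under the oracle. -/
def outOKH (K : SymCertR) (oracle : Word → HintT) (κ : Word → ℕ) (J i : ℕ) : Bool :=
  isZero (canonNFZH K.frame oracle (shareR K κ J i))

/-- The per-module facts `i, i+1, …` (frame-list form). -/
def OutFactsH (K : SymCertR) (oracle : Word → HintT) (κ : Word → ℕ) (J : ℕ) : ℕ → ℕ → Prop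
  | _, 0 => True
  | i, n + 1 => outOKH K oracle κ J i = true ∧ OutFactsH K oracle κ J (i + 1) n

/-- Facts on the output classes `i … i+n−1` expand the sum of those shares into their hinted uses. -/
theorem sum_outFactsH (K : SymCertR) (oracle : Word → HintT) (κ : Word → ℕ) (J : ℕ) {Λ' : Finset (Site 2)}
    (hFL : K.frame.toFinset ⊆ Λ') (hQ : ∀ k, PSupp (shareR K κ J k) K.frame.toFinset) :
    ∀ (n i : ℕ), OutFactsH K oracle κ J i n →
      (((List.range' i n).map (shareR K κ J)).map (polyOp Λ')).sum =
        ((((List.range' i n).map (shareR K κ J)).flatMap (canonNFZHUses K.frame oracle)).map (useOp Λ')).sum := by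
  intro n
  induction n with
  | zero => intro i _; simp
  | succ n ih =>
    intro i h
    rw [List.range'_succ, List.map_cons, List.map_cons, List.sum_cons, List.flatMap_cons, List.map_append, List.sum_append,
      ih (i + 1) h.2]
    have hexp := canonNFZH_expansion K.frame hFL oracle (shareR K κ J i) ((hQ i).mono hFL)
    have hz : polyOp Λ' (canonNFZH K.frame oracle (shareR K κ J i)) = 0 := polyOp_eq_zero_of_isZero Λ' _ h.1
    rw [hz, zero_add] at hexp
    rw [hexp]

/-- Twin of `wardD4CertGe_of_outroute` (OutRoute l.251): the use-family closing `wardD4CertGe_of_expansion` fed exactly as in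
`wardD4CertGe_of_facts₂ZR` (GramRShardsGrouped l.56) with the HINTED uses of the shares (supports: `canonNFZHUses_supp`) and no partials. -/
theorem wardD4CertGe_of_outrouteH (K : SymCertR) (hwf0 : wellFormed K.expand = true)
    (hRok : K.gramR.all (gramBlockROK K.frame) = true) (oracle : Word → HintT) (κ : Word → ℕ) (J : ℕ) (hJ : 0 < J)
    (hfacts : OutFactsH K oracle κ J 0 J) : WardD4CertGe ((symValueR K : ℚ) : ℝ) := by
  have hwfb : wellFormed K.toSymCert = true := wellFormed_toSymCert_of_expand K hwf0
  have hRok' : ∀ B ∈ K.gramR, gramBlockROK K.frame B = true := List.all_eq_true.1 hRok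
  have hsD := supp_of_gramROK K hRok
  have hQ : ∀ k, PSupp (shareR K κ J k) K.frame.toFinset := fun k => by
    rw [shareR_eq]; exact (PSupp_rawResidualR K hwfb hRok).filter _
  /- the DERIVED use family and its envelope -/
  let U := (sharesR K κ J).flatMap (canonNFZHUses K.frame oracle) ++ (K.gramR.flatMap blockUses).map negUse
  have hL : (envelope K.expand U).toList.toFinset = envelope K.expand U := Finset.toList_toFinset _
  have hFL : K.frame.toFinset ⊆ (envelope K.expand U).toList.toFinset := by
    rw [hL]; exact (subset_thicken _ 1).trans (thicken_subset_envelope K.expand U)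
  have hU : ∀ e ∈ U, SuppIn e.u K.expand.frame.toFinset := by
    intro e he
    rcases List.mem_append.1 he with he | he
    · rw [List.mem_flatMap] at he
      obtain ⟨Q, hQ', he⟩ := he
      rw [sharesR, List.mem_map] at hQ'
      obtain ⟨k, -, rfl⟩ := hQ'
      exact canonNFZHUses_supp K.frame oracle _ (hQ k) e he
    · rw [List.mem_map] at he
      obtain ⟨e', he', rfl⟩ := he
      rw [List.mem_flatMap] at he'
      obtain ⟨B, hB, he'⟩ := he'
      rw [blockUses, List.mem_flatMap] at he'
      obtain ⟨m, -, he'⟩ := he'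
      obtain ⟨t, ht, hu⟩ := polyUses_u he'
      show SuppIn e'.u K.frame.toFinset
      rw [hu]
      exact PSupp_gramBlockPolyR B (hsD B hB).1 (hsD B hB).2 t ht
  refine wardD4CertGe_of_expansion K.expand hwf0 U hU ?_
  /- the expansion -/
  have hBL : ∀ B ∈ K.gramR, (∀ s ∈ B.reps, PSupp (genPre B.moves s) (envelope K.expand U).toList.toFinset) ∧
      ∀ q ∈ genBasis B, ∀ m ∈ B.moves,
        PSupp (movePolyF m.γ m.v q) (envelope K.expand U).toList.toFinset ∧
          isZero (psub (nfPoly (movePolyF m.γ m.v q)) (pscale m.χ q)) = true := fun B hB =>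
    ⟨fun s hs => (((gramBlockROK_spec (hRok' B hB)).1 s hs).2).mono hFL,
      fun q hq m hm => ⟨((gramBlockROK_spec (hRok' B hB)).2 q hq m hm).1.mono hFL,
        ((gramBlockROK_spec (hRok' B hB)).2 q hq m hm).2⟩⟩
  have h2 := polyOp_rhsPoly_expand (envelope K.expand U).toList.toFinset K hBL
  have hsum := sum_outFactsH K oracle κ J hFL hQ J 0 hfacts
  rw [← List.range_eq_range'] at hsum
  change ((sharesR K κ J).map _).sum =
    (((sharesR K κ J).flatMap (canonNFZHUses K.frame oracle)).map (useOp (envelope K.expand U).toList.toFinset)).sum at hsum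
  rw [sum_sharesR K hwfb κ hJ hFL] at hsum
  have hl : lhsPoly K.expand = lhsPoly K.toSymCert := rfl
  have hneg : (((K.gramR.flatMap blockUses).map negUse).map (useOp (envelope K.expand U).toList.toFinset)).sum =
      -((K.gramR.flatMap blockUses).map (useOp (envelope K.expand U).toList.toFinset)).sum := by
    rw [List.map_map, ← list_sum_map_neg]
    simp only [Function.comp_def, useOp_negUse]
  rw [hl, h2, List.map_append, List.sum_append, hneg, ← hsum]
  abel

/-- Twin of `energyDensity_ge_of_outroute` (OutRoute l.264): the closing a v1/E-class `Cert.lean` would cite. -/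
theorem energyDensity_ge_of_outrouteH (K : SymCertR) (hwf : wellFormed K.expand = true)
    (hRok : K.gramR.all (gramBlockROK K.frame) = true) (oracle : Word → HintT) (κ : Word → ℕ) (J : ℕ) (hJ : 0 < J)
    (hfacts : OutFactsH K oracle κ J 0 J) :
    ((symValueR K : ℚ) : ℝ) ≤ energyDensityTT' 1 0 8 (7 / 8) :=
  energyDensity_ge_of_windowSound_cert _ WardSlot.stub_wardWindowSound (wardD4CertGe_of_outrouteH K hwf hRok oracle κ J hJ hfacts)

/-! ##### (c) Box form (path of record for box frames; twin of `…OutRoute` §Box-canon form): the licence test is the O(|w|) `inBox lo hi`; under `boxLicence frame lo hi` every box object IS the frame object -/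

/-- Validated partner, box form. -/
def partnerOfB (lo hi : ℤ × ℤ) (h : HintT) (u : Word) : Option (DihedralGroup 4 × Site 2) :=
  match h.partner with
  | none => none
  | some p =>
    if inBox lo hi (moveWordV p.1 p.2 u) && polyNegEq (nfWord (moveWordV h.γ h.v u)) (nfWord (moveWordV p.1 p.2 u))
    then some p else none

/-- Hinted term canon, box form. -/
def canonTermHWB (lo hi : ℤ × ℤ) (h : HintT) (t : ℚ × Word) : QPoly :=
  if inBox lo hi (moveWordV h.γ h.v t.2) then
    match partnerOfB lo hi h t.2 with
    | some _ => []
    | none => pscale t.1 (nfWord (moveWordV h.γ h.v t.2))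
  else [t]

/-- Hinted zero-filtered pipe, box form. -/
def canonNFZHB (lo hi : ℤ × ℤ) (oracle : Word → HintT) (p : QPoly) : QPoly :=
  (dropZeros (collect (nfPoly p))).flatMap fun t => canonTermHWB lo hi (oracle t.2) t

/-- Per-module fact, box form. -/
def outOKHB (K : SymCertR) (oracle : Word → HintT) (κ : Word → ℕ) (J : ℕ) (lo hi : ℤ × ℤ) (i : ℕ) : Bool :=
  isZero (canonNFZHB lo hi oracle (shareR K κ J i))

/-- The per-module facts, box form. -/
def OutFactsHB (K : SymCertR) (oracle : Word → HintT) (κ : Word → ℕ) (J : ℕ) (lo hi : ℤ × ℤ) : ℕ → ℕ → Prop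
  | _, 0 => True
  | i, n + 1 => outOKHB K oracle κ J lo hi i = true ∧ OutFactsHB K oracle κ J lo hi (i + 1) n

/-- Under the licence the box partner test IS the frame-list test. -/
theorem partnerOfB_eq {frame : List (Site 2)} {lo hi : ℤ × ℤ} (hb : boxLicence frame lo hi = true) (h : HintT) (u : Word) :
    partnerOfB lo hi h u = partnerOf frame h u := by
  unfold partnerOfB partnerOf
  simp only [moveWordV_eq, inBox_eq_suppIn hb]

/-- Under the licence the box term canon IS the frame-list term canon. -/
theorem canonTermHWB_eq {frame : List (Site 2)} {lo hi : ℤ × ℤ} (hb : boxLicence frame lo hi = true) (h : HintT) (t : ℚ × Word) :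
    canonTermHWB lo hi h t = canonTermHW frame h t := by
  unfold canonTermHWB canonTermHW
  simp only [moveWordV_eq, inBox_eq_suppIn hb, partnerOfB_eq hb]

/-- Under the licence the box pipe IS the frame-list pipe. -/
theorem canonNFZHB_eq {frame : List (Site 2)} {lo hi : ℤ × ℤ} (hb : boxLicence frame lo hi = true)
    (oracle : Word → HintT) (p : QPoly) : canonNFZHB lo hi oracle p = canonNFZH frame oracle p := by
  unfold canonNFZHB canonNFZH canonTermH
  simp only [canonTermHWB_eq hb]

/-- Under the licence the box fact IS the frame-list fact. -/
theorem outOKHB_eq (K : SymCertR) (oracle : Word → HintT) (κ : Word → ℕ) (J : ℕ) {lo hi : ℤ × ℤ}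
    (hb : boxLicence K.frame lo hi = true) (i : ℕ) : outOKHB K oracle κ J lo hi i = outOKH K oracle κ J i := by
  rw [outOKHB, outOKH, canonNFZHB_eq hb]

/-- Box facts give frame-list facts. -/
theorem outFactsH_of_B (K : SymCertR) (oracle : Word → HintT) (κ : Word → ℕ) (J : ℕ) {lo hi : ℤ × ℤ}
    (hb : boxLicence K.frame lo hi = true) :
    ∀ (n i : ℕ), OutFactsHB K oracle κ J lo hi i n → OutFactsH K oracle κ J i n := by
  intro n
  induction n with
  | zero => intro i _; exact trivial
  | succ n ih => intro i hf; exact ⟨(outOKHB_eq K oracle κ J hb i).symm.trans hf.1, ih (i + 1) hf.2⟩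

/-- **E5 closing, box form**: CLOSING GRAMMAR per module `i < J` one file
`theorem out_i : outOKHB K oracle κ J lo hi i = true := by native_decide` (the oracle — e.g. sym-ref-1 g1's packed `canonPH` through
an adapter `Hint → HintT`, `k ↦ γof k`, `(amin, bmin) ↦ mkSite (−amin) (−bmin)` — runs INSIDE this evaluation; no hint data is shipped),
then `hfacts : OutFactsHB K oracle κ J lo hi 0 J := ⟨out_0, …, out_{J−1}, trivial⟩`. -/
theorem energyDensity_ge_of_outrouteHB (K : SymCertR) (hwf : wellFormed K.expand = true)
    (hRok : K.gramR.all (gramBlockROK K.frame) = true) (oracle : Word → HintT) (κ : Word → ℕ) (J : ℕ) (hJ : 0 < J)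
    (lo hi : ℤ × ℤ) (hbox : boxLicence K.frame lo hi = true) (hfacts : OutFactsHB K oracle κ J lo hi 0 J) :
    ((symValueR K : ℚ) : ℝ) ≤ energyDensityTT' 1 0 8 (7 / 8) :=
  energyDensity_ge_of_outrouteH K hwf hRok oracle κ J hJ (outFactsH_of_B K oracle κ J hbox J 0 hfacts)

/-! ##### (d) Executed form: the closed-form move of `…BoxCanonZ` in every licence test and image (equal to (c) as functions) -/

/-- Validated partner, executed form. -/
def partnerOfBZ (lo hi : ℤ × ℤ) (h : HintT) (u : Word) : Option (DihedralGroup 4 × Site 2) :=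
  match h.partner with
  | none => none
  | some p =>
    if inBox lo hi (moveWordZ p.1 p.2 u) && polyNegEq (nfWord (moveWordZ h.γ h.v u)) (nfWord (moveWordZ p.1 p.2 u))
    then some p else none

/-- Hinted term canon, executed form. -/
def canonTermHWBZ (lo hi : ℤ × ℤ) (h : HintT) (t : ℚ × Word) : QPoly :=
  if inBox lo hi (moveWordZ h.γ h.v t.2) then
    match partnerOfBZ lo hi h t.2 with
    | some _ => []
    | none => pscale t.1 (nfWord (moveWordZ h.γ h.v t.2))
  else [t]

/-- Hinted zero-filtered pipe, executed form. -/
def canonNFZHBZ (lo hi : ℤ × ℤ) (oracle : Word → HintT) (p : QPoly) : QPoly :=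
  (dropZeros (collect (nfPoly p))).flatMap fun t => canonTermHWBZ lo hi (oracle t.2) t

/-- **Per-module fact, executed form** (the `native_decide` target). -/
def outOKHBZ (K : SymCertR) (oracle : Word → HintT) (κ : Word → ℕ) (J : ℕ) (lo hi : ℤ × ℤ) (i : ℕ) : Bool :=
  isZero (canonNFZHBZ lo hi oracle (shareR K κ J i))

/-- The per-module facts, executed form. -/
def OutFactsHBZ (K : SymCertR) (oracle : Word → HintT) (κ : Word → ℕ) (J : ℕ) (lo hi : ℤ × ℤ) : ℕ → ℕ → Prop
  | _, 0 => True
  | i, n + 1 => outOKHBZ K oracle κ J lo hi i = true ∧ OutFactsHBZ K oracle κ J lo hi (i + 1) n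

/-- `partnerOfBZ = partnerOfB`. -/
theorem partnerOfBZ_eq : partnerOfBZ = partnerOfB := by
  funext lo hi h u; unfold partnerOfBZ partnerOfB; simp only [moveWordZ_eq']

/-- `canonTermHWBZ = canonTermHWB`. -/
theorem canonTermHWBZ_eq : canonTermHWBZ = canonTermHWB := by
  funext lo hi h t; unfold canonTermHWBZ canonTermHWB; simp only [moveWordZ_eq', partnerOfBZ_eq]

/-- `canonNFZHBZ = canonNFZHB`. -/
theorem canonNFZHBZ_eq : canonNFZHBZ = canonNFZHB := by
  funext lo hi oracle p; unfold canonNFZHBZ canonNFZHB; simp only [canonTermHWBZ_eq]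

/-- `outOKHBZ = outOKHB`. -/
theorem outOKHBZ_eq : outOKHBZ = outOKHB := by
  funext K oracle κ J lo hi i; rw [outOKHBZ, outOKHB, canonNFZHBZ_eq]

/-- Executed facts give box facts. -/
theorem outFactsHB_of_Z (K : SymCertR) (oracle : Word → HintT) (κ : Word → ℕ) (J : ℕ) (lo hi : ℤ × ℤ) :
    ∀ (n i : ℕ), OutFactsHBZ K oracle κ J lo hi i n → OutFactsHB K oracle κ J lo hi i n := by
  intro n
  induction n with
  | zero => intro i _; exact trivial
  | succ n ih =>
    intro i hf
    exact ⟨by rw [← hf.1, outOKHBZ_eq], ih (i + 1) hf.2⟩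

/-- **E5 closing, executed form**: per module `i < J` one file `theorem out_i : outOKHBZ K oracle κ J lo hi i = true := by native_decide`,
then `hfacts := ⟨out_0, …, out_{J−1}, trivial⟩`. -/
theorem energyDensity_ge_of_outrouteHBZ (K : SymCertR) (hwf : wellFormed K.expand = true)
    (hRok : K.gramR.all (gramBlockROK K.frame) = true) (oracle : Word → HintT) (κ : Word → ℕ) (J : ℕ) (hJ : 0 < J)
    (lo hi : ℤ × ℤ) (hbox : boxLicence K.frame lo hi = true) (hfacts : OutFactsHBZ K oracle κ J lo hi 0 J) :
    ((symValueR K : ℚ) : ℝ) ≤ energyDensityTT' 1 0 8 (7 / 8) :=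
  energyDensity_ge_of_outrouteHB K hwf hRok oracle κ J hJ lo hi hbox (outFactsHB_of_Z K oracle κ J lo hi J 0 hfacts)

/-! ##### (e) Kernel demo: one word, a hand hint; the verified step is the tree's `nfWord` of the moved word -/

/-- Demo word `c†_{(1,0),↑} c_{(0,−1),↑}`. -/
def demoWordE5 : Word := [⟨mkSite 1 0, 0, true⟩, ⟨mkSite 0 (-1), 0, false⟩]

/-- Demo hint: rotate by `r 1`, translate by `(−11, −12)`, no zero claim. -/
def demoHintE5 : HintT := ⟨.r 1, mkSite (-11) (-12), none⟩

example : inBox ((-12 : ℤ), (-12 : ℤ)) ((12 : ℤ), (12 : ℤ)) (moveWordZ demoHintE5.γ demoHintE5.v demoWordE5) = true := by decide +kernel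
example : (canonTermHWBZ ((-12 : ℤ), (-12 : ℤ)) ((12 : ℤ), (12 : ℤ)) demoHintE5 ((3 : ℚ), demoWordE5)).length = 1 := by decide +kernel
/-- An unlicensed hint leaves the term unchanged (so the module fact fails rather than certifying anything). -/
example : (match canonTermHWBZ ((-12 : ℤ), (-12 : ℤ)) ((12 : ℤ), (12 : ℤ)) ⟨.r 0, mkSite 100 0, none⟩ ((3 : ℚ), demoWordE5) with
    | [(q, w)] => decide (q = 3) && wordEq w demoWordE5
    | _ => false) = true := by decide +kernel

end Summit.Ventures.CertifiedManyBodySolver.Theorems.SymReplay.E5L
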